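import Summits.Parity.GeneralizedHardyLittlewood.Theorems.FordMaynardSieveConst01651SieveConst01651BuchstabCuts
import Summits.Parity.GeneralizedHardyLittlewood.Theorems.FordMaynardNoSieveConst0164NegWitness0164CellFaces
import Summits.Parity.GeneralizedHardyLittlewood.Theorems.FordMaynardNoSieveConst0164NegWitness0164J3
import Summits.Parity.GeneralizedHardyLittlewood.Theorems.FordMaynardNoSieveConst0164NegWitness0164HalfPoint
import HarnessLib

/-!
# Route `FordMaynardSieveConst01651`, target `SieveConst01651` (stmt-Parity-19185), stub `stub_certValuePos` (R2):
# the `r = 3` pairing is non-negative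

Def-free helper file.  In the cut form (`…BuchstabCuts.sieveBoundG1_coneCert_eq_cut`) the `g₃` term is
`I₃ = ∫_{(0,1/2]} S⁰_3(t) Φ₆(1−t) dt`.  The table part `g₃ ≥ 0` (values `0.876398, 0.941613, 0`), the face part of the
witness lives on finitely many hyperplanes of the two-dimensional slice (coordinates on grid edges, pair sums on the band
lines), which are null unless `t = 1/2`; and `Φ₆ ≥ 0`.  Hence (`pairing_three_nonneg`) **`I₃ ≥ 0`** — the certificate
drops it.

* `sliceIntegral_three_congr_ae_faces` — slice integrals over `Δ₃(t)` of integrands agreeing off finitely many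
  coordinate values and pair-sum values coincide (null lines of `ℝ²`);
* `gTab_three_nonneg`, `sliceFnOrd_three_eq_tab` (`t ≠ 1/2`), `sliceFnOrd_three_nonneg`, `pairing_three_nonneg`.

References: [FordMaynard2024PrimeSieves] arXiv:2407.14368, Theorem 7.3 (a), §8.2.
-/

noncomputable section

open MeasureTheory Set Finset
open scoped Classical
open Literature.NumberTheory.Sieve Literature.NumberTheory.Sieve.FordMaynard
open Literature.Analysis.Convolution
open Summit.Parity.GeneralizedHardyLittlewood.FordMaynardNoSieveConst0164NegWitness0164

namespace Summit.Parity.GeneralizedHardyLittlewood.FordMaynardSieveConst01651SieveConst01651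

/-- **Faces are null on the two-dimensional slice.**  If `G = G'` at every `v ∈ (0,∞)³` with `|v| = t` whose
coordinates avoid the finite set `A` and whose pair sums avoid the finite set `B`, then `∫_{Δ₃(t)} G = ∫_{Δ₃(t)} G'`.
[folklore] -/
theorem sliceIntegral_three_congr_ae_faces (t : ℝ) {A B : Set ℝ} (hA : A.Finite) (hB : B.Finite)
    {G G' : (Fin 3 → ℝ) → ℝ}
    (h : ∀ v : Fin 3 → ℝ, (∀ i, 0 < v i) → ∑ i, v i = t → (∀ k, v k ∉ A) →
      v 0 + v 1 ∉ B → v 0 + v 2 ∉ B → v 1 + v 2 ∉ B → G v = G' v) :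
    sliceIntegral 3 t G = sliceIntegral 3 t G' := by
  rw [sliceIntegral_succ_eq, sliceIntegral_succ_eq]
  refine integral_congr_ae ?_
  -- the exceptional set
  set N : Set (Fin 2 → ℝ) :=
    (⋃ a ∈ A, ({u : Fin 2 → ℝ | u 0 = a} ∪ {u | u 1 = a} ∪ {u | u 0 + u 1 = t - a})) ∪
      ⋃ b ∈ B, ({u : Fin 2 → ℝ | u 0 + u 1 = b} ∪ {u | u 1 = t - b} ∪ {u | u 0 = t - b}) with hN
  have hnull : volume N = 0 := by
    rw [hN]
    refine measure_union_null ?_ ?_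
    · refine (measure_biUnion_null_iff hA.countable).2 fun a _ => ?_
      exact measure_union_null (measure_union_null (volume_coord_eq_zero_fin_two 0 _)
        (volume_coord_eq_zero_fin_two 1 _)) (volume_add_eq_zero_fin_two _)
    · refine (measure_biUnion_null_iff hB.countable).2 fun b _ => ?_
      exact measure_union_null (measure_union_null (volume_add_eq_zero_fin_two _)
        (volume_coord_eq_zero_fin_two 1 _)) (volume_coord_eq_zero_fin_two 0 _)
  refine (measure_mono_null (fun u hu => ?_) hnull : volume {u : Fin 2 → ℝ | ¬ _} = 0)
  by_contra hmem
  apply hu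
  change sliceIntegrand 2 t G u = sliceIntegrand 2 t G' u
  unfold sliceIntegrand
  by_cases hc : (∀ i : Fin 2, 0 < u i) ∧ ∑ i, u i < t
  · rw [if_pos hc, if_pos hc]
    have hmem' : ∀ a ∈ A, u 0 ≠ a ∧ u 1 ≠ a ∧ u 0 + u 1 ≠ t - a := by
      intro a ha
      refine ⟨fun h' => hmem ?_, fun h' => hmem ?_, fun h' => hmem ?_⟩ <;> rw [hN] <;> left <;>
        simp only [Set.mem_iUnion, Set.mem_union, Set.mem_setOf_eq] <;> exact ⟨a, ha, by tauto⟩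
    have hmemB : ∀ b ∈ B, u 0 + u 1 ≠ b ∧ u 1 ≠ t - b ∧ u 0 ≠ t - b := by
      intro b hb
      refine ⟨fun h' => hmem ?_, fun h' => hmem ?_, fun h' => hmem ?_⟩ <;> rw [hN] <;> right <;>
        simp only [Set.mem_iUnion, Set.mem_union, Set.mem_setOf_eq] <;> exact ⟨b, hb, by tauto⟩
    have hsum2 : ∑ i : Fin 2, u i = u 0 + u 1 := Fin.sum_univ_two u
    apply h
    · intro i
      rw [snoc_fin_two_eq]
      fin_cases i
      · simpa using hc.1 0
      · simpa using hc.1 1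
      · simp; linarith [hc.2]
    · rw [snoc_fin_two_eq, Fin.sum_univ_three]
      simp [hsum2]
    · intro k hk
      rw [snoc_fin_two_eq] at hk
      fin_cases k
      · exact (hmem' _ (by simpa using hk)).1 (by simp)
      · exact (hmem' _ (by simpa using hk)).2.1 (by simp)
      · have hk' : t - (u 0 + u 1) ∈ A := by simpa [hsum2] using hk
        exact (hmem' _ hk').2.2 (by ring)
    · intro hk
      rw [snoc_fin_two_eq] at hk
      exact (hmemB _ (by simpa using hk)).1 (by simp)
    · intro hk
      rw [snoc_fin_two_eq] at hk
      have hk' : u 0 + (t - (u 0 + u 1)) ∈ B := by simpa [hsum2] using hk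
      exact (hmemB _ hk').2.1 (by ring)
    · intro hk
      rw [snoc_fin_two_eq] at hk
      have hk' : u 1 + (t - (u 0 + u 1)) ∈ B := by simpa [hsum2] using hk
      exact (hmemB _ hk').2.2 (by ring)
  · rw [if_neg hc, if_neg hc]

/-- The table part `g₃` is non-negative. [folklore] -/
theorem gTab_three_nonneg (y : Fin 3 → ℝ) : 0 ≤ gTab 3 y := by
  show 0 ≤ (fun y : Fin 3 → ℝ => if Monotone y ∧ (∀ i, y i ∈ openSmall) ∧ ∑ i, y i < 1 / 2 then
    (g3Lookup (cellIdx (y 0)) (cellIdx (y 1)) (cellIdx (y 2)) : ℝ) / 1000000 else 0) y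
  simp only
  split_ifs
  · apply div_nonneg _ (by norm_num)
    unfold g3Lookup
    split_ifs <;> simp
  · exact le_rfl

/-- **`S⁰_3(t)` equals its table version for `t ≠ 1/2`** (the face part is invisible). [folklore] -/
theorem sliceFnOrd_three_eq_tab {t : ℝ} (ht : t ≠ 1 / 2) :
    sliceIntegral 3 t
        (fun v => if (∀ i, (1651 / 10000 : ℝ) < v i) ∧ Monotone v then coneCert 3 v / ∏ i, v i else 0) =
      sliceIntegral 3 t
        (fun v => if (∀ i, (1651 / 10000 : ℝ) < v i) ∧ Monotone v then gTab 3 v / ∏ i, v i else 0) := by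
  have hB : ({(8349 / 20000 : ℝ), 1 / 2} : Set ℝ).Finite := by simp
  refine sliceIntegral_three_congr_ae_faces t edgeSet_finite hB fun v _ hsum hA h01 h02 h12 => ?_
  have hface : gFace 3 v = 0 := by
    refine gFace_eq_zero_of_generic hA (fun i j hij => ?_) (fun _ => by rw [hsum]; exact ht)
    have key : ∀ i j : Fin 3, i < j → v i + v j ∉ ({(8349 / 20000 : ℝ), 1 / 2} : Set ℝ) := by
      intro i j hij
      fin_cases i <;> fin_cases j <;> simp_all (config := {decide := true})
    have := key i j hij
    simp only [Set.mem_insert_iff, Set.mem_singleton_iff, not_or] at this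
    exact this
  simp only [coneCert, hface, add_zero]

/-- **`S⁰_3(t) ≥ 0` for `t ≠ 1/2`.** [folklore] -/
theorem sliceFnOrd_three_nonneg {t : ℝ} (ht : t ≠ 1 / 2) :
    0 ≤ sliceIntegral 3 t
        (fun v => if (∀ i, (1651 / 10000 : ℝ) < v i) ∧ Monotone v then coneCert 3 v / ∏ i, v i else 0) := by
  rw [sliceFnOrd_three_eq_tab ht]
  refine sliceIntegral_nonneg_of 3 t _ fun v hv _ => ?_
  split_ifs
  · exact div_nonneg (gTab_three_nonneg v) (Finset.prod_nonneg fun i _ => (hv i).le)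
  · exact le_rfl

/-- **The `r = 3` pairing is non-negative**: `0 ≤ ∫_{(0,1/2]} S⁰_3(t) Φ₆(1−t) dt`. [folklore] -/
theorem pairing_three_nonneg :
    0 ≤ ∫ t in Set.Ioc 0 (1 / 2), sliceIntegral 3 t
        (fun v => if (∀ i, (1651 / 10000 : ℝ) < v i) ∧ Monotone v then coneCert 3 v / ∏ i, v i else 0) *
      ∑ m ∈ Finset.Icc 1 6, (1 / (m.factorial : ℝ)) *
        cpow (fun t : ℝ => if (1651 / 10000 : ℝ) < t then 1 / t else 0) m (1 - t) := by
  refine setIntegral_nonneg_ae measurableSet_Ioc ?_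
  filter_upwards [Measure.ae_ne volume (1 / 2 : ℝ)] with t ht _
  exact mul_nonneg (sliceFnOrd_three_nonneg ht) (buchstabPhi_nonneg (by norm_num) 6 (1 - t))

end Summit.Parity.GeneralizedHardyLittlewood.FordMaynardSieveConst01651SieveConst01651

end
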